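import Mathlib
import Literature.Algebra.Polynomial.HermiteRealRootedness
import Literature.LinearAlgebra.Matrix.HermitianFormsPolarization
import HarnessLib

/-!
# Hermite's theorem: rank and signature of the Hermite matrix

Source: S. Basu, R. Pollack, M.-F. Roy, *Algorithms in Real Algebraic Geometry* (2nd ed., 2006),
§4.3.2, **Thm. 4.57 (Hermite)**: for a real polynomial `P`, the Hermite quadratic form
`Her(P,1) = Σ_{x ∈ Zer(P,ℂ)} μ(x)(f₀ + f₁x + ⋯ + f_{p−1}x^{p−1})²`, whose matrix is the Hankel matrix
of Newton sums (the tree's `Literature.Algebra.Polynomial.hermiteMatrix`), has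
**rank = number of distinct complex roots** and **signature = number of distinct real roots**
[cite: BasuPollackRoy2006, Thm. 4.57]; restated as Thm. 1.1 of Netzer–Plaumann–Thom,
*Determinantal representations and the Hermite matrix* (arXiv:1108.4380)
[cite: NetzerPlaumannThom2013, Thm. 1.1].  The tree file `HermiteRealRootedness.lean` proves only the
corollary «real-rooted ⇔ PSD» and records Thm. 4.57 as not formalised; this file proves it.

## Proof (the printed one, BPR proof of Thm. 4.57, run through the tree's law of inertia)

Over `ℂⁿ` (`n ≥ deg P`), `z* H z = Σ_{x ∈ S} μ(x) · conj(L_{x̄} z) · L_x z` with `S` the distinct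
roots and `L_x z = Σ_j x^j z_j` (`hermQuad_hermiteMatrixC`).  Pairing `x` with `x̄` gives the signed
decomposition `Re z*Hz = Σ_{x ∈ S} c_x ‖P_x z‖²` (`hermQuad_re_eq_sum_sgnWeight`): `c_x = μ(x)`,
`P_x = L_x` for real `x`; `c_x = ±μ(x)/2`, `P_x = L_x ± L_x̄` for the upper/lower member of a
conjugate pair.  The `P_x` are jointly onto (Lagrange interpolation at the `|S| ≤ n` nodes,
`surjective_pi_pform`), so the inertia inequalities of
`Literature.LinearAlgebra.Matrix.HermitianFormsPolarization` (`card_pos_le_of_decompositions`, the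
machinery behind the tree's PROVED `LawOfInertia`) identify the numbers of positive / negative
eigenvalues with the numbers of positive / negative weights: `#real + #pairs` and `#pairs`.

## Main statements (all proved; for the complexified matrix `hermiteMatrixC P n = (hermiteMatrix P n).map ofReal`)

* `card_eigenvalues_hermiteMatrixC`: `#{λ > 0} = #(distinct real roots) + #(conjugate pairs)`,
  `#{λ < 0} = #(conjugate pairs)` — so the signature is the number of distinct real roots;
* `rank_hermiteMatrixC`: `rank = #(distinct complex roots)`.

* `card_eigenvalues_hermiteMatrix`, `signature_hermiteMatrix`, `rank_hermiteMatrix`,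
  `rank_hermiteMatrix_eq_natDegree_iff`: the same statements for the REAL symmetric matrix
  `hermiteMatrix P n` (transfer through the common characteristic polynomial:
  `Matrix.charpoly_map` + `IsHermitian.roots_charpoly_eq_eigenvalues`).

Typed-vs-printed: the core statements are proved for the complex hermitian matrix
`(hermiteMatrix P n).map ofReal` and then transferred to `Matrix.rank` / `IsHermitian.eigenvalues`
of the real symmetric `hermiteMatrix P n` (last section), for any size `n ≥ deg P`
(printed: `n = p = deg P`); "signature" is rendered as the pair of counts `#{λ > 0}`, `#{λ < 0}`
(and their difference, `signature_hermiteMatrix`).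
-/

noncomputable section

open Polynomial Finset Matrix
open scoped ComplexConjugate

namespace Literature.Algebra.Polynomial.HermiteSignature

open Literature.Algebra.Polynomial
open Literature.LinearAlgebra.Matrix.HermitianFormsPolarization

/-- The evaluation functional `L_μ(z) = Σ_j μ^j z_j` on `ℂⁿ` (`z` = coefficient vector of a
polynomial of degree `< n`, `L_μ z` = its value at `μ`; the linear forms of BPR's proof).
[cite: BasuPollackRoy2006, Thm. 4.57 (proof)] -/
def lform (n : ℕ) (μ : ℂ) : (Fin n → ℂ) →ₗ[ℂ] ℂ :=
  Fintype.linearCombination ℂ fun j : Fin n => μ ^ (j : ℕ)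

/-- Unfolding `L_μ`. [cite: BasuPollackRoy2006, Thm. 4.57 (proof)] -/
theorem lform_apply (n : ℕ) (μ : ℂ) (z : Fin n → ℂ) : lform n μ z = ∑ j, z j * μ ^ (j : ℕ) := by
  simp [lform, Fintype.linearCombination_apply, smul_eq_mul]

/-- `conj (L_{μ̄} z) = Σ_j conj(z_j) μ^j`. [cite: BasuPollackRoy2006, Thm. 4.57 (proof)] -/
theorem conj_lform_conj (n : ℕ) (μ : ℂ) (z : Fin n → ℂ) :
    conj (lform n (conj μ) z) = ∑ j, conj (z j) * μ ^ (j : ℕ) := by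
  rw [lform_apply, map_sum]
  refine Finset.sum_congr rfl fun j _ => ?_
  rw [map_mul, map_pow, Complex.conj_conj]

/-- The complexified Hermite matrix `(N_{i+j}(P))` as a complex (hermitian) matrix.
[cite: BasuPollackRoy2006, §4.3.2 (the matrix `Newt₀(P)` of `Her(P,1)`)] -/
def hermiteMatrixC (P : ℝ[X]) (n : ℕ) : Matrix (Fin n) (Fin n) ℂ :=
  (hermiteMatrix P n).map (algebraMap ℝ ℂ)

/-- Entries: complex Newton sums. [cite: BasuPollackRoy2006, §4.3.2] -/
theorem hermiteMatrixC_apply (P : ℝ[X]) (n : ℕ) (i j : Fin n) :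
    hermiteMatrixC P n i j = newtonSumC P ((i : ℕ) + j) := by
  simp [hermiteMatrixC, hermiteMatrix_apply, ofReal_newtonSum]

/-- The complexified Hermite matrix is hermitian. [cite: BasuPollackRoy2006, §4.3.2] -/
theorem hermiteMatrixC_isHermitian (P : ℝ[X]) (n : ℕ) : (hermiteMatrixC P n).IsHermitian := by
  refine Matrix.IsHermitian.ext fun i j => ?_
  rw [hermiteMatrixC_apply, hermiteMatrixC_apply, add_comm, RCLike.star_def, conj_newtonSumC]

/-- **Hermite's quadratic form over `ℂ`:** `z* H z = Σ_{x ∈ Zer(P)} μ(x) · conj(L_{x̄} z) · L_x z`,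
written with distinct roots `S` and multiplicities. [cite: BasuPollackRoy2006, §4.3.2 and Thm. 4.57 (proof)] -/
theorem hermQuad_hermiteMatrixC (P : ℝ[X]) (n : ℕ) (z : Fin n → ℂ) :
    hermQuad (hermiteMatrixC P n) z =
      ∑ x ∈ (P.aroots ℂ).toFinset, ((P.aroots ℂ).count x : ℂ) *
        (conj (lform n (conj x) z) * lform n x z) := by
  classical
  rw [hermQuad, dotProduct]
  simp only [mulVec, dotProduct, hermiteMatrixC_apply, newtonSumC_def, Pi.star_apply,
    RCLike.star_def]
  -- exchange the finite sums with the multiset sum over the roots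
  have hx : ∀ x : ℂ, conj (lform n (conj x) z) * lform n x z =
      ∑ i : Fin n, ∑ j : Fin n, conj (z i) * (x ^ ((i : ℕ) + (j : ℕ)) * z j) := by
    intro x
    rw [conj_lform_conj, lform_apply, Finset.sum_mul_sum]
    refine Finset.sum_congr rfl fun i _ => Finset.sum_congr rfl fun j _ => ?_
    ring
  have hR : ∑ x ∈ (P.aroots ℂ).toFinset, ((P.aroots ℂ).count x : ℂ) *
      (conj (lform n (conj x) z) * lform n x z) =
      ((P.aroots ℂ).map fun x => ∑ i : Fin n, ∑ j : Fin n,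
        conj (z i) * (x ^ ((i : ℕ) + (j : ℕ)) * z j)).sum := by
    rw [Finset.sum_multiset_map_count]
    refine Finset.sum_congr rfl fun x _ => ?_
    rw [nsmul_eq_mul, hx]
  rw [hR, multiset_sum_map_finset_sum]
  refine Finset.sum_congr rfl fun i _ => ?_
  rw [multiset_sum_map_finset_sum, Finset.mul_sum]
  refine Finset.sum_congr rfl fun j _ => ?_
  rw [Multiset.sum_map_mul_left, Multiset.sum_map_mul_right]

/-- Multiplicities are invariant under conjugation (real polynomial). [cite: BasuPollackRoy2006, Thm. 4.57 (proof)] -/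
theorem count_conj_aroots (P : ℝ[X]) (x : ℂ) :
    (P.aroots ℂ).count (conj x) = (P.aroots ℂ).count x := by
  conv_lhs => rw [← map_conj_aroots P]
  exact Multiset.count_map_eq_count' _ _ (starRingEnd ℂ).injective _

/-- The distinct roots are closed under conjugation. [cite: BasuPollackRoy2006, Thm. 4.57 (proof)] -/
theorem conj_mem_aroots_toFinset {P : ℝ[X]} {x : ℂ} (hx : x ∈ (P.aroots ℂ).toFinset) :
    conj x ∈ (P.aroots ℂ).toFinset := by
  rw [Multiset.mem_toFinset] at hx ⊢
  rw [← map_conj_aroots P]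
  exact Multiset.mem_map_of_mem _ hx

/-- The signed weights of the decomposition: `m(x)` for real roots, `± m(x)/2` for the two members
of a conjugate pair. [cite: BasuPollackRoy2006, Thm. 4.57 (proof)] -/
def sgnWeight (P : ℝ[X]) (x : ℂ) : ℝ :=
  if x.im = 0 then ((P.aroots ℂ).count x : ℝ)
  else if 0 < x.im then ((P.aroots ℂ).count x : ℝ) / 2 else -(((P.aroots ℂ).count x : ℝ) / 2)

/-- The forms of the decomposition: `L_x` for real `x`, `L_x + L_x̄` / `L_x̄ − L_x` for the upper /
lower member of a conjugate pair. [cite: BasuPollackRoy2006, Thm. 4.57 (proof)] -/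
def pform (n : ℕ) (x : ℂ) : (Fin n → ℂ) →ₗ[ℂ] ℂ :=
  if x.im = 0 then lform n x
  else if 0 < x.im then lform n x + lform n (conj x) else lform n (conj x) - lform n x

/-- Termwise pairing identity behind the signed decomposition. [folklore] -/
private theorem pair_identity (P : ℝ[X]) (n : ℕ) (z : Fin n → ℂ) (x : ℂ) :
    ((P.aroots ℂ).count x : ℂ) * (conj (lform n (conj x) z) * lform n x z) +
      ((P.aroots ℂ).count (conj x) : ℂ) * (conj (lform n (conj (conj x)) z) * lform n (conj x) z) =
    ((sgnWeight P x * ‖pform n x z‖ ^ 2 : ℝ) : ℂ) +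
      ((sgnWeight P (conj x) * ‖pform n (conj x) z‖ ^ 2 : ℝ) : ℂ) := by
  rw [count_conj_aroots, Complex.conj_conj]
  set m : ℂ := ((P.aroots ℂ).count x : ℂ) with hm
  set u := lform n x z with hu
  set w := lform n (conj x) z with hw
  by_cases hx : x.im = 0
  · -- real root: `conj x = x`
    have hcx : conj x = x := Complex.conj_eq_iff_im.mpr hx
    have hwu : w = u := by rw [hw, hcx]
    simp only [sgnWeight, pform, hx, if_true, hcx]
    push_cast
    rw [← Complex.conj_mul', hwu, ← hu]
  · by_cases hpos : 0 < x.im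
    · have hneg : ¬ 0 < (conj x).im := by rw [Complex.conj_im]; linarith
      have hne : (conj x).im ≠ 0 := by rw [Complex.conj_im]; exact neg_ne_zero.mpr hx
      simp only [sgnWeight, pform, hx, hpos, hne, hneg, if_false, if_true, Complex.conj_conj,
        count_conj_aroots, LinearMap.add_apply, LinearMap.sub_apply]
      push_cast
      rw [← Complex.conj_mul', ← Complex.conj_mul', map_add, map_sub, ← hu, ← hw]
      ring
    · have hlt : x.im < 0 := lt_of_le_of_ne (not_lt.mp hpos) hx
      have hpos' : 0 < (conj x).im := by rw [Complex.conj_im]; linarith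
      have hne : (conj x).im ≠ 0 := by rw [Complex.conj_im]; exact neg_ne_zero.mpr hx
      simp only [sgnWeight, pform, hx, hpos, hne, hpos', if_false, if_true, Complex.conj_conj,
        count_conj_aroots, LinearMap.add_apply, LinearMap.sub_apply]
      push_cast
      rw [← Complex.conj_mul', ← Complex.conj_mul', map_add, map_sub, ← hu, ← hw]
      ring

/-- **The signed-square decomposition of Hermite's form:**
`Re(z* H z) = Σ_{x ∈ S} c_x ‖P_x z‖²` over the distinct roots `S`. [cite: BasuPollackRoy2006, Thm. 4.57 (proof)] -/
theorem hermQuad_re_eq_sum_sgnWeight (P : ℝ[X]) (n : ℕ) (z : Fin n → ℂ) :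
    (hermQuad (hermiteMatrixC P n) z).re =
      ∑ x : (P.aroots ℂ).toFinset, sgnWeight P x * ‖pform n x z‖ ^ 2 := by
  classical
  set S := (P.aroots ℂ).toFinset with hS
  set f : ℂ → ℂ := fun x => ((P.aroots ℂ).count x : ℂ) * (conj (lform n (conj x) z) * lform n x z)
    with hf
  set h : ℂ → ℝ := fun x => sgnWeight P x * ‖pform n x z‖ ^ 2 with hh
  -- sums over `S` are invariant under `x ↦ conj x`
  have hbij : ∀ g : ℂ → ℂ, ∑ x ∈ S, g (conj x) = ∑ x ∈ S, g x := by
    intro g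
    refine Finset.sum_nbij (fun x => conj x) (fun x hx => conj_mem_aroots_toFinset hx)
      (fun x _ y _ hxy => (starRingEnd ℂ).injective hxy)
      (fun y hy => ⟨conj y, conj_mem_aroots_toFinset hy, Complex.conj_conj y⟩) (fun x _ => rfl)
  have hpair : ∑ x ∈ S, (f x + f (conj x)) = ∑ x ∈ S, (((h x : ℝ) : ℂ) + ((h (conj x) : ℝ) : ℂ)) :=
    Finset.sum_congr rfl fun x _ => by simp only [hf, hh]; exact pair_identity P n z x
  have hL2 : ∑ x ∈ S, (f x + f (conj x)) = 2 * ∑ x ∈ S, f x := by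
    rw [Finset.sum_add_distrib, hbij f, two_mul]
  have hR2 : ∑ x ∈ S, (((h x : ℝ) : ℂ) + ((h (conj x) : ℝ) : ℂ)) = 2 * ∑ x ∈ S, ((h x : ℝ) : ℂ) := by
    rw [Finset.sum_add_distrib, hbij (fun x => ((h x : ℝ) : ℂ)), two_mul]
  have hsumC : ∑ x ∈ S, f x = ∑ x ∈ S, ((h x : ℝ) : ℂ) :=
    mul_left_cancel₀ two_ne_zero (by rw [← hL2, ← hR2, hpair])
  rw [hermQuad_hermiteMatrixC, ← hS]
  change (∑ x ∈ S, f x).re = _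
  rw [hsumC, ← Complex.ofReal_sum, Complex.ofReal_re, Finset.sum_coe_sort S h]

/-- **Interpolation:** the evaluation functionals at the distinct roots are jointly onto when there
are at most `n` of them (`z` = coefficients of the Lagrange interpolation polynomial; «linearly
independent linear forms» in the printed proof). [cite: BasuPollackRoy2006, Thm. 4.57 (proof)] -/
theorem surjective_pi_lform (S : Finset ℂ) {n : ℕ} (hS : S.card ≤ n) :
    Function.Surjective (LinearMap.pi fun x : S => lform n (x : ℂ)) := by
  classical
  intro y
  set r : ℂ → ℂ := fun w => if h : w ∈ S then y ⟨w, h⟩ else 0 with hr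
  set L : ℂ[X] := Lagrange.interpolate S id r with hL
  have hLdeg : L.degree < S.card := Lagrange.degree_interpolate_lt _ (Set.injOn_id _)
  have hLn : L.natDegree < n ∨ L = 0 := by
    by_cases h0 : L = 0
    · exact Or.inr h0
    · left
      have := (Polynomial.natDegree_lt_iff_degree_lt h0).mpr hLdeg
      omega
  refine ⟨fun j => L.coeff j, ?_⟩
  funext x
  rw [LinearMap.pi_apply, lform_apply]
  have hnode : L.eval (x : ℂ) = y x := by
    have h := Lagrange.eval_interpolate_at_node r (Set.injOn_id (s := (S : Set ℂ))) x.2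
    simp only [← hL, id_eq] at h
    rw [h, hr]
    simp
  rw [← hnode]
  rcases hLn with hlt | h0
  · rw [Polynomial.eval_eq_sum_range' hlt, Fin.sum_univ_eq_sum_range (fun j => L.coeff j * (x : ℂ) ^ j) n]
  · simp [h0]

/-- The forms `P_x` of the signed decomposition are jointly onto (they are an invertible
recombination of the evaluation functionals within each conjugate pair). [cite: BasuPollackRoy2006, Thm. 4.57 (proof)] -/
theorem surjective_pi_pform (P : ℝ[X]) {n : ℕ} (hn : (P.aroots ℂ).toFinset.card ≤ n) :
    Function.Surjective (LinearMap.pi fun x : (P.aroots ℂ).toFinset => pform n (x : ℂ)) := by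
  classical
  set S := (P.aroots ℂ).toFinset with hS
  intro t
  -- the conjugate of a node, as a node
  let cj : S → S := fun x => ⟨conj (x : ℂ), conj_mem_aroots_toFinset x.2⟩
  have hcj : ∀ x : S, ((cj x : S) : ℂ) = conj (x : ℂ) := fun x => rfl
  have hcjcj : ∀ x : S, cj (cj x) = x := fun x => Subtype.ext (by rw [hcj, hcj, Complex.conj_conj])
  -- target values for the evaluation functionals
  let y : S → ℂ := fun x =>
    if (x : ℂ).im = 0 then t x
    else if 0 < (x : ℂ).im then (t x + t (cj x)) / 2 else (t (cj x) - t x) / 2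
  obtain ⟨z, hz⟩ := surjective_pi_lform S hn y
  have hzx : ∀ x : S, lform n (x : ℂ) z = y x := fun x => by
    have := congr_fun hz x
    rwa [LinearMap.pi_apply] at this
  refine ⟨z, funext fun x => ?_⟩
  rw [LinearMap.pi_apply]
  by_cases hx : (x : ℂ).im = 0
  · simp only [pform, hx, if_true, hzx x, y]
  · by_cases hpos : 0 < (x : ℂ).im
    · have h1 : lform n (conj (x : ℂ)) z = y (cj x) := by rw [← hcj, hzx]
      have hcim : ¬ ((cj x : S) : ℂ).im = 0 := by rw [hcj, Complex.conj_im]; exact neg_ne_zero.mpr hx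
      have hcpos : ¬ 0 < ((cj x : S) : ℂ).im := by rw [hcj, Complex.conj_im]; linarith
      simp only [pform, hx, hpos, if_false, if_true, LinearMap.add_apply, hzx x, h1, y, hcim, hcpos,
        hcjcj]
      ring
    · have hlt : (x : ℂ).im < 0 := lt_of_le_of_ne (not_lt.mp hpos) hx
      have h1 : lform n (conj (x : ℂ)) z = y (cj x) := by rw [← hcj, hzx]
      have hcim : ¬ ((cj x : S) : ℂ).im = 0 := by rw [hcj, Complex.conj_im]; exact neg_ne_zero.mpr hx
      have hcpos : 0 < ((cj x : S) : ℂ).im := by rw [hcj, Complex.conj_im]; linarith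
      simp only [pform, hx, hpos, if_false, LinearMap.sub_apply, hzx x, h1, y, hcim, hcpos, if_true,
        hcjcj]
      ring

/-- There are at most `deg P` distinct complex roots. [cite: BasuPollackRoy2006, Thm. 4.57] -/
theorem natDegree_ge_card_aroots_toFinset (P : ℝ[X]) : (P.aroots ℂ).toFinset.card ≤ P.natDegree := by
  refine (Multiset.toFinset_card_le _).trans ?_
  have h := Polynomial.card_roots' (P.map (algebraMap ℝ ℂ))
  rwa [natDegree_map] at h

/-- **Inertia count for the Hermite matrix (core).** The numbers of positive / negative eigenvalues
of the complexified Hermite matrix (size `n ≥ deg P`) are the numbers of distinct roots carrying a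
positive / negative weight in the signed decomposition (law of inertia, tree
`card_pos_le_of_decompositions`). [cite: BasuPollackRoy2006, Thm. 4.57 (proof)] -/
theorem card_eigenvalues_eq_card_sgnWeight (P : ℝ[X]) {n : ℕ} (hn : P.natDegree ≤ n) :
    Fintype.card {i // 0 < (hermiteMatrixC_isHermitian P n).eigenvalues i} =
        Fintype.card {x : (P.aroots ℂ).toFinset // 0 < sgnWeight P x} ∧
      Fintype.card {i // 0 < -(hermiteMatrixC_isHermitian P n).eigenvalues i} =
        Fintype.card {x : (P.aroots ℂ).toFinset // 0 < -sgnWeight P x} := by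
  classical
  set A := hermiteMatrixC P n with hAdef
  have hA : A.IsHermitian := hermiteMatrixC_isHermitian P n
  set q : (Fin n → ℂ) → ℝ := fun z => (hermQuad A z).re with hqdef
  -- decomposition 1: the signed squares over the distinct roots
  set S := (P.aroots ℂ).toFinset with hS
  set Pf : S → (Fin n → ℂ) →ₗ[ℂ] ℂ := fun x => pform n (x : ℂ) with hPf
  set c : S → ℝ := fun x => sgnWeight P (x : ℂ) with hcdef
  have hq1 : ∀ z, q z = ∑ x, c x * ‖Pf x z‖ ^ 2 := fun z => by
    rw [hqdef]
    exact hermQuad_re_eq_sum_sgnWeight P n z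
  have hsurjP : Function.Surjective (LinearMap.pi Pf) :=
    surjective_pi_pform P ((natDegree_ge_card_aroots_toFinset P).trans hn)
  -- decomposition 2: orthonormal eigen-coordinates
  set U : Matrix (Fin n) (Fin n) ℂ := (hA.eigenvectorUnitary : Matrix (Fin n) (Fin n) ℂ) with hUdef
  set L : Fin n → (Fin n → ℂ) →ₗ[ℂ] ℂ := fun i => (LinearMap.proj i).comp (Matrix.mulVecLin (star U))
    with hLdef
  have hL : ∀ i z, L i z = (star U *ᵥ z) i := fun i z => rfl
  have hq2 : ∀ z, q z = ∑ i, hA.eigenvalues i * ‖L i z‖ ^ 2 := fun z => by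
    simp only [hqdef, hermQuad_eq_sum_eigenvalues_mul_normSq hA z, Complex.re_sum,
      Complex.re_ofReal_mul, Complex.ofReal_re, hL, ← hUdef]
  have hUU : star U * U = 1 := Unitary.star_mul_self_of_mem hA.eigenvectorUnitary.prop
  have hsurjL : Function.Surjective (LinearMap.pi L) := fun w => by
    refine ⟨U *ᵥ w, ?_⟩
    funext i
    rw [LinearMap.pi_apply, hL, mulVec_mulVec, hUU, one_mulVec]
  have h1 := card_pos_le_of_decompositions q Pf c L hA.eigenvalues hq1 hq2 hsurjP
  have h2 := card_pos_le_of_decompositions q L hA.eigenvalues Pf c hq2 hq1 hsurjL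
  have h3 := card_neg_le_of_decompositions q Pf c L hA.eigenvalues hq1 hq2 hsurjP
  have h4 := card_neg_le_of_decompositions q L hA.eigenvalues Pf c hq2 hq1 hsurjL
  exact ⟨le_antisymm h2 h1, le_antisymm h4 h3⟩

/-- A distinct root carries a positive weight iff it is real or in the upper half-plane. [cite: BasuPollackRoy2006, Thm. 4.57 (proof)] -/
theorem sgnWeight_pos_iff {P : ℝ[X]} {x : ℂ} (hx : x ∈ (P.aroots ℂ).toFinset) :
    0 < sgnWeight P x ↔ x.im = 0 ∨ 0 < x.im := by
  have hm : 0 < ((P.aroots ℂ).count x : ℝ) := by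
    exact_mod_cast Multiset.count_pos.mpr (Multiset.mem_toFinset.mp hx)
  unfold sgnWeight
  split_ifs with h1 h2
  · exact ⟨fun _ => Or.inl h1, fun _ => hm⟩
  · exact ⟨fun _ => Or.inr h2, fun _ => by linarith [hm]⟩
  · constructor
    · intro h; linarith
    · rintro (h | h) <;> [exact absurd h h1; exact absurd h h2]

/-- A distinct root carries a negative weight iff it is in the lower half-plane. [cite: BasuPollackRoy2006, Thm. 4.57 (proof)] -/
theorem sgnWeight_neg_iff {P : ℝ[X]} {x : ℂ} (hx : x ∈ (P.aroots ℂ).toFinset) :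
    0 < -sgnWeight P x ↔ x.im < 0 := by
  have hm : 0 < ((P.aroots ℂ).count x : ℝ) := by
    exact_mod_cast Multiset.count_pos.mpr (Multiset.mem_toFinset.mp hx)
  unfold sgnWeight
  split_ifs with h1 h2
  · constructor
    · intro h; linarith
    · intro h; rw [h1] at h; exact absurd h (lt_irrefl 0)
  · constructor
    · intro h; linarith
    · intro h; linarith
  · constructor
    · intro _; exact lt_of_le_of_ne (not_lt.mp h2) h1
    · intro _; linarith

/-- Counting inside a finset-subtype. [folklore] -/
private theorem card_subtype_coe_eq_card_filter (S : Finset ℂ) (p : ℂ → Prop) [DecidablePred p] :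
    Fintype.card {x : S // p x} = (S.filter p).card := by
  rw [← Fintype.card_coe (S.filter p)]
  refine Fintype.card_congr ((Equiv.subtypeSubtypeEquivSubtypeInter (fun x => x ∈ S) p).trans
    (Equiv.subtypeEquivRight fun x => ?_))
  rw [Finset.mem_filter]

/-- The number of positively weighted distinct roots = #(distinct real roots) + #(roots in the upper
half-plane); negatively weighted = #(roots in the lower half-plane). [cite: BasuPollackRoy2006, Thm. 4.57 (proof)] -/
theorem card_sgnWeight_pos_neg (P : ℝ[X]) :
    Fintype.card {x : (P.aroots ℂ).toFinset // 0 < sgnWeight P x} =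
        ((P.aroots ℂ).toFinset.filter fun x => x.im = 0).card +
          ((P.aroots ℂ).toFinset.filter fun x => 0 < x.im).card ∧
      Fintype.card {x : (P.aroots ℂ).toFinset // 0 < -sgnWeight P x} =
        ((P.aroots ℂ).toFinset.filter fun x => x.im < 0).card := by
  classical
  set S := (P.aroots ℂ).toFinset with hS
  constructor
  · have h1 : Fintype.card {x : S // 0 < sgnWeight P x} =
        Fintype.card {x : S // (x : ℂ).im = 0 ∨ 0 < (x : ℂ).im} :=
      Fintype.card_congr (Equiv.subtypeEquivRight fun x => sgnWeight_pos_iff x.2)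
    rw [h1, card_subtype_coe_eq_card_filter S (fun x => x.im = 0 ∨ 0 < x.im), Finset.filter_or,
      Finset.card_union_of_disjoint]
    exact Finset.disjoint_filter.mpr fun x _ h0 hpos => by rw [h0] at hpos; exact lt_irrefl _ hpos
  · have h1 : Fintype.card {x : S // 0 < -sgnWeight P x} = Fintype.card {x : S // (x : ℂ).im < 0} :=
      Fintype.card_congr (Equiv.subtypeEquivRight fun x => sgnWeight_neg_iff x.2)
    rw [h1, card_subtype_coe_eq_card_filter S (fun x => x.im < 0)]

/-- Conjugation matches the roots in the upper and lower half-planes. [cite: BasuPollackRoy2006, Thm. 4.57 (proof)] -/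
theorem card_upper_eq_card_lower (P : ℝ[X]) :
    ((P.aroots ℂ).toFinset.filter fun x => 0 < x.im).card =
      ((P.aroots ℂ).toFinset.filter fun x => x.im < 0).card := by
  classical
  refine Finset.card_nbij (fun x => conj x) (fun x hx => ?_) (fun x _ y _ hxy => (starRingEnd ℂ).injective hxy)
    (fun y hy => ?_)
  · simp only [Finset.mem_coe, Finset.mem_filter] at hx ⊢
    exact ⟨conj_mem_aroots_toFinset hx.1, by rw [Complex.conj_im]; linarith [hx.2]⟩
  · simp only [Finset.mem_coe, Finset.mem_filter] at hy
    refine ⟨conj y, ?_, Complex.conj_conj y⟩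
    simp only [Finset.mem_coe, Finset.mem_filter]
    exact ⟨conj_mem_aroots_toFinset hy.1, by rw [Complex.conj_im]; linarith [hy.2]⟩

/-- The distinct complex roots on the real axis are the distinct real roots. [cite: BasuPollackRoy2006, Thm. 4.57] -/
theorem card_filter_im_eq_zero (P : ℝ[X]) :
    ((P.aroots ℂ).toFinset.filter fun x => x.im = 0).card = P.roots.toFinset.card := by
  classical
  have key : ∀ r : ℝ, aeval (r : ℂ) P = ((eval r P : ℝ) : ℂ) := fun r => by
    rw [← Complex.coe_algebraMap, aeval_algebraMap_apply_eq_algebraMap_eval]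
  have hmap : ((P.aroots ℂ).toFinset.filter fun x => x.im = 0) =
      P.roots.toFinset.map ⟨((↑) : ℝ → ℂ), Complex.ofReal_injective⟩ := by
    ext x
    rw [Finset.mem_filter, Finset.mem_map, Multiset.mem_toFinset, mem_aroots]
    constructor
    · rintro ⟨⟨hP, hx⟩, him⟩
      have hxre : (x.re : ℂ) = x := Complex.ext rfl (by simp [him])
      refine ⟨x.re, ?_, hxre⟩
      rw [Multiset.mem_toFinset, mem_roots hP, IsRoot.def]
      rw [← hxre, key] at hx
      exact_mod_cast hx
    · rintro ⟨r, hr, rfl⟩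
      rw [Multiset.mem_toFinset, mem_roots', IsRoot.def] at hr
      refine ⟨⟨hr.1, ?_⟩, Complex.ofReal_im r⟩
      simp only [Function.Embedding.coeFn_mk]
      rw [key, hr.2, Complex.ofReal_zero]
  rw [hmap, Finset.card_map]

/-- **Hermite's theorem (BPR Thm. 4.57 / NPT Thm. 1.1), signature.** For `n ≥ deg P`, the
(complexified) Hermite matrix has `#(distinct real roots) + #(conjugate pairs of non-real roots)`
positive eigenvalues and `#(conjugate pairs)` negative ones; in particular its signature
`#{λ > 0} − #{λ < 0}` is the number of distinct real roots of `P`.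
[cite: BasuPollackRoy2006, Thm. 4.57] [cite: NetzerPlaumannThom2013, Thm. 1.1] -/
theorem card_eigenvalues_hermiteMatrixC (P : ℝ[X]) {n : ℕ} (hn : P.natDegree ≤ n) :
    Fintype.card {i // 0 < (hermiteMatrixC_isHermitian P n).eigenvalues i} =
        P.roots.toFinset.card + ((P.aroots ℂ).toFinset.filter fun x => 0 < x.im).card ∧
      Fintype.card {i // (hermiteMatrixC_isHermitian P n).eigenvalues i < 0} =
        ((P.aroots ℂ).toFinset.filter fun x => 0 < x.im).card := by
  obtain ⟨hpos, hneg⟩ := card_eigenvalues_eq_card_sgnWeight P hn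
  obtain ⟨hwpos, hwneg⟩ := card_sgnWeight_pos_neg P
  refine ⟨?_, ?_⟩
  · rw [hpos, hwpos, card_filter_im_eq_zero]
  · have h : Fintype.card {i // (hermiteMatrixC_isHermitian P n).eigenvalues i < 0} =
        Fintype.card {i // 0 < -(hermiteMatrixC_isHermitian P n).eigenvalues i} :=
      Fintype.card_congr (Equiv.subtypeEquivRight fun i => neg_pos.symm)
    rw [h, hneg, hwneg, card_upper_eq_card_lower]

/-- The distinct roots split into real ones and conjugate pairs: `#S = #real + 2·#pairs`. [cite: BasuPollackRoy2006, Thm. 4.57 (proof)] -/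
theorem card_aroots_toFinset_eq (P : ℝ[X]) :
    (P.aroots ℂ).toFinset.card = P.roots.toFinset.card +
      2 * ((P.aroots ℂ).toFinset.filter fun x => 0 < x.im).card := by
  classical
  set S := (P.aroots ℂ).toFinset with hS
  have h1 : S.card = (S.filter fun x => x.im = 0).card + (S.filter fun x => ¬ x.im = 0).card :=
    (Finset.card_filter_add_card_filter_not _).symm
  have h2 : (S.filter fun x => ¬ x.im = 0).card =
      (S.filter fun x => 0 < x.im).card + (S.filter fun x => x.im < 0).card := by
    rw [← Finset.card_union_of_disjoint (Finset.disjoint_filter.mpr fun x _ h1 h2 => by linarith)]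
    congr 1
    ext x
    simp only [Finset.mem_filter, Finset.mem_union]
    constructor
    · rintro ⟨hx, hne⟩
      rcases lt_or_gt_of_ne hne with h | h
      · exact Or.inr ⟨hx, h⟩
      · exact Or.inl ⟨hx, h⟩
    · rintro (⟨hx, h⟩ | ⟨hx, h⟩)
      · exact ⟨hx, ne_of_gt h⟩
      · exact ⟨hx, ne_of_lt h⟩
  rw [h1, h2, ← card_upper_eq_card_lower P, ← card_filter_im_eq_zero]
  ring

/-- **Hermite's theorem (BPR Thm. 4.57 / NPT Thm. 1.1), rank:** for `n ≥ deg P`, the rank of the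
(complexified) Hermite matrix is the number of distinct complex roots of `P`.
[cite: BasuPollackRoy2006, Thm. 4.57] [cite: NetzerPlaumannThom2013, Thm. 1.1] -/
theorem rank_hermiteMatrixC (P : ℝ[X]) {n : ℕ} (hn : P.natDegree ≤ n) :
    (hermiteMatrixC P n).rank = (P.aroots ℂ).toFinset.card := by
  classical
  have hA := hermiteMatrixC_isHermitian P n
  obtain ⟨hpos, hneg⟩ := card_eigenvalues_hermiteMatrixC P hn
  rw [hA.rank_eq_card_non_zero_eigs, card_aroots_toFinset_eq, two_mul, ← add_assoc, ← hpos, ← hneg,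
    Fintype.card_subtype, Fintype.card_subtype, Fintype.card_subtype,
    ← Finset.card_union_of_disjoint (Finset.disjoint_filter.mpr fun i _ h1 h2 => by linarith)]
  congr 1
  ext i
  simp only [Finset.mem_filter, Finset.mem_univ, true_and, Finset.mem_union]
  exact ⟨fun h => (lt_or_gt_of_ne h).symm, fun h => h.elim ne_of_gt ne_of_lt⟩


/-! ### Transfer to the real symmetric matrix `hermiteMatrix P n`

The statements above are for the complexification `(hermiteMatrix P n).map (algebraMap ℝ ℂ)`; the
real symmetric matrix has the same characteristic polynomial, hence the same multiset of (real)
eigenvalues and the same rank.  This closes the «typed-vs-printed» gap recorded in the module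
docstring: BPR Thm. 4.57 / NPT Thm. 1.1 for the REAL Hermite matrix. -/

/-- A real symmetric matrix and its complexification have the same multiset of eigenvalues (both
are the roots of the common characteristic polynomial). [folklore] -/
private theorem map_eigenvalues_eq_of_map_ofReal {n : ℕ} {A : Matrix (Fin n) (Fin n) ℝ}
    (hA : A.IsHermitian) (hB : (A.map (algebraMap ℝ ℂ)).IsHermitian) :
    Multiset.map hB.eigenvalues Finset.univ.val = Multiset.map hA.eigenvalues Finset.univ.val := by
  have e1 : (Multiset.map hB.eigenvalues Finset.univ.val).map ((↑) : ℝ → ℂ) =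
      (A.map (algebraMap ℝ ℂ)).charpoly.roots := by
    rw [hB.roots_charpoly_eq_eigenvalues, Multiset.map_map]
    rfl
  have e2 : (Multiset.map hA.eigenvalues Finset.univ.val).map ((↑) : ℝ → ℂ) =
      (A.map (algebraMap ℝ ℂ)).charpoly.roots := by
    rw [Matrix.charpoly_map, hA.splits_charpoly.roots_map, hA.roots_charpoly_eq_eigenvalues,
      Multiset.map_map, Multiset.map_map]
    refine Multiset.map_congr rfl fun x _ => ?_
    simp
  exact Multiset.map_injective Complex.ofReal_injective (e1.trans e2.symm)

/-- Counting eigenvalues with a property is the same for a real symmetric matrix and its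
complexification. [folklore] -/
private theorem card_eigenvalues_subtype_eq_of_map_ofReal {n : ℕ} {A : Matrix (Fin n) (Fin n) ℝ}
    (hA : A.IsHermitian) (hB : (A.map (algebraMap ℝ ℂ)).IsHermitian) (p : ℝ → Prop)
    [DecidablePred p] :
    Fintype.card {i // p (hA.eigenvalues i)} = Fintype.card {i // p (hB.eigenvalues i)} := by
  have key : ∀ f : Fin n → ℝ, Fintype.card {i // p (f i)} =
      Multiset.card ((Multiset.map f Finset.univ.val).filter p) := fun f => by
    rw [Fintype.card_subtype, Multiset.filter_map, Multiset.card_map, Finset.card_def,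
      Finset.filter_val]
    rfl
  rw [key, key, map_eigenvalues_eq_of_map_ofReal hA hB]

/-- **Hermite's theorem (BPR Thm. 4.57 / NPT Thm. 1.1) for the real symmetric Hermite matrix,
signature.** For `n ≥ deg P`, `hermiteMatrix P n` has `#(distinct real roots) + #(conjugate pairs)`
positive and `#(conjugate pairs)` negative eigenvalues. [cite: BasuPollackRoy2006, Thm. 4.57]
[cite: NetzerPlaumannThom2013, Thm. 1.1] -/
theorem card_eigenvalues_hermiteMatrix (P : ℝ[X]) {n : ℕ} (hn : P.natDegree ≤ n) :
    Fintype.card {i // 0 < (hermiteMatrix_isHermitian P n).eigenvalues i} =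
        P.roots.toFinset.card + ((P.aroots ℂ).toFinset.filter fun x => 0 < x.im).card ∧
      Fintype.card {i // (hermiteMatrix_isHermitian P n).eigenvalues i < 0} =
        ((P.aroots ℂ).toFinset.filter fun x => 0 < x.im).card := by
  obtain ⟨h1, h2⟩ := card_eigenvalues_hermiteMatrixC P hn
  exact ⟨(card_eigenvalues_subtype_eq_of_map_ofReal (hermiteMatrix_isHermitian P n)
      (hermiteMatrixC_isHermitian P n) (0 < ·)).trans h1,
    (card_eigenvalues_subtype_eq_of_map_ofReal (hermiteMatrix_isHermitian P n)
      (hermiteMatrixC_isHermitian P n) (· < 0)).trans h2⟩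

/-- **Hermite's theorem, signature clause (BPR Thm. 4.57 / NPT Thm. 1.1):** for `n ≥ deg P` the
signature `#{λ > 0} − #{λ < 0}` of the real symmetric matrix `hermiteMatrix P n` is the number of
distinct real roots of `P`. [cite: BasuPollackRoy2006, Thm. 4.57] [cite: NetzerPlaumannThom2013, Thm. 1.1] -/
theorem signature_hermiteMatrix (P : ℝ[X]) {n : ℕ} (hn : P.natDegree ≤ n) :
    (Fintype.card {i // 0 < (hermiteMatrix_isHermitian P n).eigenvalues i} : ℤ) -
        Fintype.card {i // (hermiteMatrix_isHermitian P n).eigenvalues i < 0} =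
      P.roots.toFinset.card := by
  obtain ⟨h1, h2⟩ := card_eigenvalues_hermiteMatrix P hn
  rw [h1, h2]
  push_cast
  ring

/-- **Hermite's theorem, rank clause (BPR Thm. 4.57 / NPT Thm. 1.1):** for `n ≥ deg P`, the rank of
the real symmetric matrix `hermiteMatrix P n` is the number of distinct complex roots of `P`.
[cite: BasuPollackRoy2006, Thm. 4.57] [cite: NetzerPlaumannThom2013, Thm. 1.1] -/
theorem rank_hermiteMatrix (P : ℝ[X]) {n : ℕ} (hn : P.natDegree ≤ n) :
    (hermiteMatrix P n).rank = (P.aroots ℂ).toFinset.card := by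
  classical
  rw [← rank_hermiteMatrixC P hn, (hermiteMatrix_isHermitian P n).rank_eq_card_non_zero_eigs,
    (hermiteMatrixC_isHermitian P n).rank_eq_card_non_zero_eigs]
  exact card_eigenvalues_subtype_eq_of_map_ofReal (hermiteMatrix_isHermitian P n)
    (hermiteMatrixC_isHermitian P n) (· ≠ 0)

/-- **Hermite's theorem, rank clause, printed size `n = deg P`:** `rank H(P) = #Zer(P, ℂ)` (distinct
complex zeros) and `rank H(P) = deg P ↔ P separable`. [cite: BasuPollackRoy2006, Thm. 4.57]
[cite: NetzerPlaumannThom2013, Thm. 1.1] -/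
theorem rank_hermiteMatrix_eq_natDegree_iff (P : ℝ[X]) (hP : P ≠ 0) :
    (hermiteMatrix P P.natDegree).rank = P.natDegree ↔ P.Separable := by
  classical
  rw [rank_hermiteMatrix P le_rfl]
  have hP0 : P.map (algebraMap ℝ ℂ) ≠ 0 := Polynomial.map_ne_zero hP
  rw [← Polynomial.separable_map (algebraMap ℝ ℂ), ← nodup_roots_iff_of_splits hP0
    (IsAlgClosed.splits _), ← aroots_def, ← Polynomial.natDegree_map (algebraMap ℝ ℂ)]
  have hcard : Multiset.card (P.aroots ℂ) = (P.map (algebraMap ℝ ℂ)).natDegree := by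
    rw [aroots_def]; exact IsAlgClosed.card_roots_eq_natDegree
  rw [← hcard, Multiset.toFinset_card_eq_card_iff_nodup]

end Literature.Algebra.Polynomial.HermiteSignature
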